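import Summits.CriticalPhenomena.PercolationContinuityZ3.Theorems.SahiMasterFamilyFrameFieldPrelim

/-!
# Frame-field disjointness at order four, II — hence (TT_4) and `MasterFamilyIdentEqIff 4`

Unit `prim-master-conj` (crux anchor stmt-CriticalPhenomena-4575), gen 11; memo HOME/prim-master-conj/TIGHTNESS-III.md §7.
Continuing part I (`TwoReaders`: a core-free coordinate `e` read by the glued frames of two members `a ≠ b`): the other two members ARE
`orElse' e = {ω | ω ⊄ {e}}` (`eq_orElse`, by T′ in the deletion face and "no member contains the others"), `{e}` lies in `U a` or `U b`
(`singleton_mem_or`), and then the contraction face at `e` cannot be structured (`false_of_singleton_mem`).  So a core-free coordinate lies in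
at most one glued block (`not_twoReaders`); with part I's cored case this gives

* **`frameFieldDisjoint_holds : FrameFieldDisjoint`**, **`terminalTight_one : TerminalTight 1`**, and
* **`masterFamilyIdentEqIff_four : MasterFamilyIdentEqIff 4`** — THE IDENTICALLY-ZERO MASTER CONJECTURE AT ORDER FOUR: for increasing events
  `U₁,…,U₄` on a finite product of two-point spaces, `E₄(μ_p; 1_{U₁},…,1_{U₄}) = 0` for every `p` in the open cube iff `(U₁,…,U₄) ∈ Z₄`.
Pure combinatorics on top of gens 6–11; axioms standard. [this work]
-/

noncomputable section

open scoped Classical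

namespace Summit.CriticalPhenomena.PercolationContinuityZ3.Theorems

namespace GluedFrames

open Finset Function
open Literature.Probability.LatticeModels.Kahn2022 (Affects)
open PositiveSomewhere (orElse' mem_orElse' isUpperSet_orElse' not_mem_orElse'_iff secAt_true_orElse' mem_esupp_orElse'
  eq_orElse'_or_univ eq_univ_of_esupp_eq_empty' univ_diff_mem_of_not_mem_esupp' mem_esupp_cframe_of_core'
  empty_mem_gframe_of_singletons' not_mem_esupp_gframe_of_core')

variable {ι : Type*} [Fintype ι] {κ : Type*} {U : κ → Set (Set ι)} {W : Finset κ}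

section TwoReaders

namespace TwoReaders

variable {e : ι} {a b : κ} (D : TwoReaders U W e a b)
include D

/-- **The other members are `orElse' e`**: every configuration with a coordinate other than `e` lies in them, `{e}` does not. [this work] -/
theorem eq_orElse {m : κ} (hma : m ≠ a) (hmb : m ≠ b) : orElse' e = U m := by
  refine Eq.symm ?_
  have hU := D.hU
  -- T′ in the deletion face: a configuration outside `(U m)^{e←0}` misses both blocks, hence is inside `{e}`
  have hsub : orElse' e ⊆ U m := by
    rintro ψ ⟨y, hy, hye⟩
    by_contra hψ
    have hψ' : ψ \ {e} ∉ faceF U e m := by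
      rw [faceF_apply, mem_secAt_false_iff_of_notMem (fun h => h.2 rfl : e ∉ ψ \ {e})]
      exact fun h => hψ (hU m Set.sdiff_subset h)
    have hA : ψ \ {e} ∈ cframe (faceF U e) W m := by rw [← D.cframe_faceF_eq_univ hma hmb]; exact Set.mem_univ _
    have h2 := two_le_card_cfail_of_annihilator (faceF U e) (isUpperSet_faceF U D.hU e) (faceF_nonempty U D.he) D.hF (D.hWU m) hA hψ'
    -- the failing set lies inside `{a, b}`: so `ψ ∖ {e}` fails the frames of `a` and `b`
    have hfail : ∀ c, c ≠ m → (c = a ∨ c = b → False) → ψ \ {e} ∈ cframe (faceF U e) W c := by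
      intro c _ hc
      rw [← D.cframe_faceF_eq_univ (fun h => hc (Or.inl h)) (fun h => hc (Or.inr h))]; exact Set.mem_univ _
    have hsubset : ((W.erase m).filter fun w => ψ \ {e} ∉ cframe (faceF U e) W w) ⊆ {a, b} := by
      intro c hc
      rw [mem_filter, mem_erase] at hc
      simp only [mem_insert, mem_singleton]
      by_contra hc'
      exact hc.2 (hfail c hc.1.1 (fun h => hc' h))
    have hcard2 : (({a, b} : Finset κ)).card = 2 := card_pair D.hab
    have heq : ((W.erase m).filter fun w => ψ \ {e} ∉ cframe (faceF U e) W w) = {a, b} :=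
      eq_of_subset_of_card_le hsubset (by rw [hcard2]; exact h2)
    have haf : a ∈ ((W.erase m).filter fun w => ψ \ {e} ∉ cframe (faceF U e) W w) := by rw [heq]; simp
    rw [mem_filter] at haf
    apply haf.2
    rw [← D.mem_cframe_faceF_a_iff]
    -- `y ∈ ψ ∖ {e}` lies in `S_a` or `S_b`; if in `S_b`, use the symmetric statement for `b`
    rcases D.mem_esupp_or hye with hyb | hya
    · exfalso
      have hbf : b ∈ ((W.erase m).filter fun w => ψ \ {e} ∉ cframe (faceF U e) W w) := by rw [heq]; simp
      rw [mem_filter] at hbf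
      exact hbf.2 ((D.symm.mem_cframe_faceF_a_iff _).1 ⟨y, ⟨hy, hye⟩, hyb⟩)
    · exact ⟨y, ⟨hy, hye⟩, hya⟩
  refine Set.Subset.antisymm (fun ω hω => ?_) hsub
  by_contra hωR
  have hωe : ω ⊆ {e} := not_mem_orElse'_iff.1 hωR
  -- then `U m` contains every non-empty configuration and absorbs every other member
  have hall : ∀ ω' : Set ι, ω'.Nonempty → ω' ∈ U m := by
    intro ω' ⟨z, hz⟩
    by_cases hz' : z = e
    · subst hz'
      by_cases hR : ω' ∈ orElse' z
      · exact hsub hR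
      · have : ω' = ω := by
          have h1 := not_mem_orElse'_iff.1 hR
          have hωz : z ∈ ω := by
            rcases Set.eq_empty_or_nonempty ω with rfl | ⟨w, hw⟩
            · exact absurd (Set.eq_univ_of_forall fun x => hU m (Set.empty_subset x) hω) (D.hns m)
            · have := hωe hw; rw [Set.mem_singleton_iff] at this; exact this ▸ hw
          exact Set.Subset.antisymm (fun x hx => by have := h1 hx; rw [Set.mem_singleton_iff] at this; exact this ▸ hωz)
            (fun x hx => by have := hωe hx; rw [Set.mem_singleton_iff] at this; exact this ▸ hz)
        rw [this]; exact hω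
    · exact hsub ⟨z, hz, hz'⟩
  obtain ⟨l, -, -, hnot⟩ := D.habs m (D.hWU m)
  exact hnot fun ω' hω' => hall ω' (Set.nonempty_iff_ne_empty.2 fun h =>
    D.hns l (Set.eq_univ_of_forall fun x => hU l (Set.empty_subset x) (h ▸ hω')))

/-- Some reader contains `{e}`. [this work] -/
theorem singleton_mem_or : ({e} : Set ι) ∈ U b ∨ ({e} : Set ι) ∈ U a := by
  refine Or.symm ?_
  -- a member `m ∉ {a,b}` exists (four members); apply "no absorber" to it
  obtain ⟨m, hm, hma, hmb⟩ : ∃ m ∈ W, m ≠ a ∧ m ≠ b := by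
    have h3 : 2 < (W.erase a).card := by rw [card_erase_of_mem (D.hWU a), D.hcard]; norm_num
    obtain ⟨m, hm, hmb⟩ := exists_mem_ne (lt_of_lt_of_le (by norm_num) h3) b
    exact ⟨m, mem_of_mem_erase hm, ne_of_mem_erase hm, hmb⟩
  obtain ⟨l, -, hlm, hnot⟩ := D.habs m hm
  have hUm := (D.eq_orElse hma hmb).symm
  -- a member `l` not contained in `orElse' e` contains `{e}`
  have key : ∀ {l}, ¬ U l ⊆ U m → ({e} : Set ι) ∈ U l := by
    intro l hnot'
    by_contra hel
    refine hnot' fun ω hω => ?_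
    rw [hUm]
    by_contra hR
    have hωe := not_mem_orElse'_iff.1 hR
    rcases Set.eq_empty_or_nonempty ω with rfl | ⟨z, hz⟩
    · exact D.hns l (Set.eq_univ_of_forall fun x => D.hU l (Set.empty_subset x) hω)
    · have hze : z = e := by have := hωe hz; rwa [Set.mem_singleton_iff] at this
      have : ω = {e} := Set.Subset.antisymm hωe (by rw [← hze]; exact Set.singleton_subset_iff.2 hz)
      exact hel (this ▸ hω)
  by_cases hla : l = a
  · exact Or.inl (key (hla ▸ hnot))
  · by_cases hlb : l = b
    · exact Or.inr (key (hlb ▸ hnot))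
    · exact absurd (by rw [← D.eq_orElse hla hlb, hUm] : U l ⊆ U m) hnot

/-- **The contraction face at `e` cannot be structured when `{e} ∈ U a`.** [this work] -/
theorem false_of_singleton_mem : ({e} : Set ι) ∉ U a := by
  intro hea
  have hU := D.hU
  set V := faceT U e with hVdef
  have hVU : ∀ k, IsUpperSet (V k) := isUpperSet_faceT U hU e
  have hVne : ∀ k, (V k).Nonempty := faceT_nonempty U hU D.hne e
  have hVS : Structured V W := D.hS e
  -- the two other members
  obtain ⟨m₁, hm₁, m₁a, m₁b⟩ : ∃ m ∈ W, m ≠ a ∧ m ≠ b := by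
    have h3 : 2 < (W.erase a).card := by rw [card_erase_of_mem (D.hWU a), D.hcard]; norm_num
    obtain ⟨m, hm, hmb⟩ := exists_mem_ne (lt_of_lt_of_le (by norm_num) h3) b
    exact ⟨m, mem_of_mem_erase hm, ne_of_mem_erase hm, hmb⟩
  obtain ⟨m₂, hm₂, m₂a, m₂b, m₂1⟩ : ∃ m ∈ W, m ≠ a ∧ m ≠ b ∧ m ≠ m₁ := by
    have h3 : 1 < ((W.erase a).erase b).card := by
      rw [card_erase_of_mem (mem_erase.2 ⟨D.hab.symm, D.hWU b⟩), card_erase_of_mem (D.hWU a), D.hcard]; norm_num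
    obtain ⟨m, hm, hm1⟩ := exists_mem_ne h3 m₁
    exact ⟨m, mem_of_mem_erase (mem_of_mem_erase hm), ne_of_mem_erase (mem_of_mem_erase hm), ne_of_mem_erase hm, hm1⟩
  -- their members in the face are `orElse' e`; the face member of `a` is everything
  have hVm : ∀ {m}, m ≠ a → m ≠ b → V m = orElse' e := by
    intro m hma hmb; rw [hVdef, faceT_apply, ← D.eq_orElse hma hmb, secAt_true_orElse']
  have hVa : V a = Set.univ := by
    refine Set.eq_univ_of_forall fun ω => ?_
    rw [hVdef, faceT_apply, mem_secAt]; simp only [forceAt, cond_true]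
    exact hU a (Set.singleton_subset_iff.2 (Set.mem_insert e ω)) hea
  -- the canonical frames of the face ignore `e` and contain the members
  have hfr : ∀ {m}, m ∈ W → secAt e true (cframe V W m) = cframe V W m :=
    fun {m} hm => cframe_faceT_ignores U W hU D.hne hVS hm
  have hRU : ∀ {m}, m ≠ a → m ≠ b → m ∈ W → cframe V W m = orElse' e ∨ cframe V W m = Set.univ := by
    intro m hma hmb hm
    exact eq_orElse'_or_univ (isUpperSet_cframe V hVU W m) (hfr hm) (by rw [← hVm hma hmb]; exact subset_cframe V hVU W m)
  -- not both `m₁, m₂` have frame `orElse' e` (equal non-empty supports)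
  obtain ⟨y, hy⟩ := Finset.nonempty_iff_ne_empty.2 D.esupp_cframe_faceF_a_nonempty
  have hye : y ≠ e := fun h => D.notMem_esupp_B a (mem_esupp.1 (h ▸ hy))
  have hnotboth : ¬ (cframe V W m₁ = orElse' e ∧ cframe V W m₂ = orElse' e) := by
    rintro ⟨h1, h2⟩
    have := disjoint_esupp_cframe V hVU hVne hVS hm₁ hm₂ m₂1.symm
    rw [h1, h2] at this
    exact Finset.disjoint_left.1 this (mem_esupp_orElse' hye) (mem_esupp_orElse' hye)
  -- one of them has frame `univ`; call it `x`, the other `x'`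
  have main : ∀ {x x'}, x ∈ W → x' ∈ W → x ≠ a → x ≠ b → x' ≠ a → x' ≠ b → x ≠ x' →
      cframe V W x = Set.univ → False := by
    intro x x' hx hx' hxa hxb hx'a hx'b hxx' hfx
    -- `∅` is annihilated by `x`; T′: two members other than `x` have a frame avoiding `∅`, and `a` is not one of them
    have h0A : (∅ : Set ι) ∈ cframe V W x := by rw [hfx]; exact Set.mem_univ _
    have h0U : (∅ : Set ι) ∉ V x := by rw [hVm hxa hxb]; rintro ⟨z, hz, -⟩; exact hz
    have h2 := two_le_card_cfail_of_annihilator V hVU hVne hVS hx h0A h0U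
    have haS : a ∉ (W.erase x).filter fun w => (∅ : Set ι) ∉ cframe V W w := by
      rw [mem_filter]; rintro ⟨-, h⟩; apply h
      exact subset_cframe V hVU W a (by rw [hVa]; exact Set.mem_univ _)
    -- so the filter is `{b, x'}` (the erase has the three elements `a, b, x'`)
    have hWeq : W = {a, b, x, x'} := by
      symm
      apply eq_of_subset_of_card_le
      · intro z hz; simp only [mem_insert, mem_singleton] at hz
        rcases hz with rfl | rfl | rfl | rfl <;> exact D.hWU _
      · rw [D.hcard, card_insert_of_notMem (by simp [D.hab, hxa.symm, hx'a.symm]),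
          card_insert_of_notMem (by simp [hxb.symm, hx'b.symm]), card_pair hxx']
    have hsub : ((W.erase x).filter fun w => (∅ : Set ι) ∉ cframe V W w) ⊆ {b, x'} := by
      intro c hc
      have hcW := mem_of_mem_erase (mem_filter.1 hc).1
      have hcx := ne_of_mem_erase (mem_filter.1 hc).1
      have hca : c ≠ a := fun h => haS (h ▸ hc)
      rw [hWeq] at hcW
      simp only [mem_insert, mem_singleton] at hcW ⊢
      rcases hcW with h | h | h | h
      · exact absurd h hca
      · exact Or.inl h
      · exact absurd h hcx
      · exact Or.inr h
    have hbx' : b ≠ x' := fun h => hx'b h.symm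
    have heq := eq_of_subset_of_card_le hsub (by rw [card_pair hbx']; exact h2)
    have hbf : b ∈ (W.erase x).filter fun w => (∅ : Set ι) ∉ cframe V W w := by rw [heq]; simp
    have hx'f : x' ∈ (W.erase x).filter fun w => (∅ : Set ι) ∉ cframe V W w := by rw [heq]; simp
    rw [mem_filter] at hbf hx'f
    -- `x'` has frame `orElse' e` (not univ), with support every `y ≠ e`; `b`'s frame is not univ but must avoid that support and `e`
    have hfx' : cframe V W x' = orElse' e := by
      rcases hRU hx'a hx'b hx' with h | h
      · exact h
      · exact absurd (by rw [h]; exact Set.mem_univ _) hx'f.2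
    have hbe : esupp (cframe V W b) = ∅ := by
      refine eq_empty_of_forall_notMem fun z hz => ?_
      by_cases hze : z = e
      · subst hze
        have := not_affects_secAt z true (cframe V W b)
        rw [hfr (D.hWU b)] at this
        exact this (mem_esupp.1 hz)
      · have hd := disjoint_esupp_cframe V hVU hVne hVS (D.hWU b) hx' hbx'
        rw [hfx'] at hd
        exact Finset.disjoint_left.1 hd hz (mem_esupp_orElse' hze)
    have := eq_univ_of_esupp_eq_empty' (isUpperSet_cframe V hVU W b)
      ⟨_, subset_cframe V hVU W b (univ_mem_of_nonempty (hVU b) (hVne b))⟩ hbe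
    exact hbf.2 (by rw [this]; exact Set.mem_univ _)
  rcases hRU m₁a m₁b hm₁ with h1 | h1
  · rcases hRU m₂a m₂b hm₂ with h2 | h2
    · exact hnotboth ⟨h1, h2⟩
    · exact main hm₂ hm₁ m₂a m₂b m₁a m₁b m₂1 h2
  · exact main hm₁ hm₂ m₁a m₁b m₂a m₂b m₂1.symm h1

end TwoReaders

/-- **A core-free coordinate lies in at most one glued block**: there are no two readers. [this work] -/
theorem not_twoReaders {e : ι} {a b : κ} : ¬ TwoReaders U W e a b := fun D => by
  rcases D.singleton_mem_or with h | h
  · exact D.symm.false_of_singleton_mem h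
  · exact D.false_of_singleton_mem h

end TwoReaders

/-! ### FrameFieldDisjoint, (TT_4), (EQI-4) -/

/-- **Frame-field disjointness holds.** [this work] -/
theorem frameFieldDisjoint_holds : FrameFieldDisjoint := by
  intro ι _ U hU hne h0 _ _ _ hall habs hE0 _ x x' hxx'
  have hns : ∀ k, U k ≠ Set.univ := fun k hk => h0 k (hk ▸ Set.mem_univ _)
  have hι : ∀ f : ι, ∃ h, h ≠ f := by
    intro f; by_contra hsub; push Not at hsub
    have hmem : ∀ j (ω : Set ι), ω ∈ U j ↔ f ∈ ω := by
      intro j ω; constructor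
      · intro hω; by_contra hfω
        have : ω = ∅ := Set.eq_empty_of_forall_notMem fun y hy => hfω ((hsub y) ▸ hy)
        exact h0 j (this ▸ hω)
      · intro hfω
        have : ω = Set.univ := Set.eq_univ_of_forall fun y => (hsub y).symm ▸ hfω
        rw [this]; exact univ_mem_of_nonempty (hU j) (hne j)
    obtain ⟨l, -, hnot⟩ := habs 0
    exact hnot fun ω hω => (hmem 0 ω).2 ((hmem l ω).1 hω)
  have hS : ∀ h, Structured (faceT U h) univ := by
    intro h
    have hz : SuppZeroFlag (2 + 2) (fun j => faceT U h (id j)) := by exact hall h true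
    have := structured_of_suppZeroFlag 2 (faceT U h) (isUpperSet_faceT U hU h) (faceT_nonempty U hU hne h) id injective_id hz
    convert this using 2; simp
  rw [Finset.disjoint_left]
  intro y hy hy'
  by_cases hcf : CoreFree U y
  · have hF : Structured (faceF U y) univ := by
      have hz : SuppZeroFlag (2 + 2) (fun j => faceF U y (id j)) := by exact hall y false
      have := structured_of_suppZeroFlag 2 (faceF U y) (isUpperSet_faceF U hU y) (faceF_nonempty U hcf) id injective_id hz
      convert this using 2; simp
    exact (not_twoReaders
      { hU := hU, hne := hne, hns := hns, hWU := mem_univ, hcard := by simp, hS := hS,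
        habs := fun l _ => by obtain ⟨m, hm, h⟩ := habs l; exact ⟨m, mem_univ m, hm, h⟩,
        hι := hι, he := hcf, hF := hF, hab := hxx', ha := hy, hb := hy' } : False)
  · -- `y` is cored by some member `k`; then it lies in the glued block of `k` only
    obtain ⟨k, hk⟩ : ∃ k, Set.univ \ {y} ∉ U k := by unfold CoreFree at hcf; push Not at hcf; exact hcf
    have hcore : ∀ ω ∈ U k, y ∈ ω := by
      intro ω hω; by_contra hyω
      exact hk (hU k (fun z hz => ⟨Set.mem_univ z, fun hzy => hyω (hzy ▸ hz)⟩ : ω ⊆ Set.univ \ {y}) hω)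
    by_cases hxk : x = k
    · subst hxk
      exact not_mem_esupp_gframe_of_core' U univ hU hne hS (mem_univ x) (mem_univ x') hxx'.symm hcore hy'
    · exact not_mem_esupp_gframe_of_core' U univ hU hne hS (mem_univ k) (mem_univ x) hxk hcore hy

/-- **(TT_4): terminal quadruples are tight.** [this work] -/
theorem terminalTight_one : TerminalTight 1 := terminalTight_one_of_frameFieldDisjoint frameFieldDisjoint_holds

/-- **THE IDENTICALLY-ZERO MASTER CONJECTURE AT ORDER FOUR.**  For increasing events `U₁,…,U₄` on a finite product of two-point spaces,
`E₄(μ_p; 1_{U₁},…,1_{U₄}) = 0` for every `p` in the open cube iff `(U₁,…,U₄) ∈ Z₄`. [this work] -/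
theorem masterFamilyIdentEqIff_four : MasterFamilyIdentEqIff 4 :=
  masterFamilyIdentEqIff_four_of_frameFieldDisjoint frameFieldDisjoint_holds

end GluedFrames

end Summit.CriticalPhenomena.PercolationContinuityZ3.Theorems
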